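import Literature.MathematicalPhysics.QuantumFieldTheory.Balaban1983to89.B1Ineq225DecayBackgroundTorus
import Literature.MathematicalPhysics.QuantumFieldTheory.Balaban1983to89.B4Eq222SupDecayObs
import Literature.MathematicalPhysics.QuantumFieldTheory.Balaban1983to89.B1TorusCubeDerivInput

/-!
# `Balaban1983to89.B1Ineq225DerivDecayBackgroundTorus` — T. Bałaban, *(Higgs)₂,₃ quantum fields in a finite volume. I. A lower bound*,
# Commun. Math. Phys. **85** (1982) 603–626 [Balaban1982Higgs1], Prop. 2.1 (2.25) **DERIVATIVE CLAUSE WITH ITS DECAY FACTOR**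
# `|(D^ε_AG^ε_K(T_ε,A)g)(b)| ≦ c₀(L^Kε)exp(−δ₀(L^Kε)⁻¹dist(b, supp g))‖g‖_∞` ON `Ω = T_ε` AT THE REGULAR BACKGROUND `A = A^{(K),ε} ≠ 0`
# OF (3.29) — PROVED FOR THE (Higgs)₂,₃ CARRIER from B4's Theorem (1.10) derivative member = [Balaban1983RegularityDecay] (2.12)–(2.13)
# ⇒ (2.22) for the observable `D^ε_A∘G` (this seat's `B4Eq222SupDecayObs`) with the per-cube derivative input of `B1TorusCubeDeriv` /
# `B1TorusCubeDerivInput` (Lemma 2.2 (2.17) derivative member on the torus cubes)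

statement-level skeleton of published theorems with citation tags; proofs where landed; nothing here is a claim about the Yang–Mills mass gap

PDF held: `paper:balaban1982-cmp85-higgs23-i` pp. 604–605, 610, 617 [PDF 2–3, 8, 15]; `paper:balaban1983-cmp89-regularity-decay` pp. 573, 575–579 [PDF 3, 5–9].

CITATION HEADER (lean-in-tree rule).  Cell `lit-balaban` (HOME `run/shared/lean/pub/lit-balaban/`), Phase-2 proof seat **p35** gen 9 (unit
`lit-balaban-p35`); SKELETON rows **B1.Prop2.1** ((2.25) DERIVATIVE clause WITH DECAY, `A = A^{(K),ε} ≠ 0`, `Ω = T_ε`: MODEL INSTANCE) and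
**B4.Thm@573** ((1.10) derivative member with `exp(−δ₀dist)` on the torus at a regular background).  USED BY NAME, never restated: this
seat's `B1Ineq225DecayBackgroundTorus.{tdist_le_of_near, eight_rS_le}`, `B4Eq222SupDecayObs.norm_obs_inverse_apply_le_of_dist`,
`B1TorusCubeDeriv.{covDeriv_hsmul, norm_covDeriv_hsmul_le}`, `B1TorusCubeDerivInput.cube_input_deriv`; gen 8's `B1TorusCubeBoxOp.cube_inputs`,
`B1TorusCubeCover`, `B1TorusCubeLocality26`, `B1Ineq225BackgroundTorus.norm_sderiv_bgVec_le`; p14's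
`B1Ineq225DerivZeroFieldTorus.covDeriv_propagatorK_sup_bound`; r14's `B1Ineq234LevelZero.tdist_triangle_real`, r15's `B1Ineq234Concrete.tdist_self`.
WHAT IS PRINTED (p. 610 [PDF 8]).  L39, for the propagator `G_k(Ω,A)` RESCALED TO THE `η = L^{−k}`-LATTICE (2.22), verbatim: *"|(D^η_{A,μ}G_k(Ω,A)f)(x)|,
|(G_k(Ω,A)f)(x)| ≦ c₀exp(−δ₀dist(x, supp f))‖f‖_∞ (2.25) for x ∈ Ω, dist(x,Ω^c) ≧ R₀"*, constants per L32–33 *"δ₀, c₀, R₀ independent of A, k, Ω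
and depending on d, a, M only, c₀ on α also"* (the letters `a`/`α` read on the ×2 render, docfix S-B1-g39-2 of ref-4 gen 39, filed gen 13; no
declaration changed).  (2.25) RESCALED TO `T_ε` (the reading used below; a unit conversion `G^ε_k = (L^kε)²G_k`,
`D^ε = (L^kε)^{−1}D^η`, distances in `L^kε`-units — not a quotation): `|(D^ε_AG^ε_k(Ω,A)f)(b)| ≦ c₀(L^kε)exp(−δ₀(L^kε)^{−1}dist(b, supp f))sup|f|`,
`|(G^ε_k(Ω,A)f)(x)| ≦ c₀(L^kε)²exp(−δ₀(L^kε)^{−1}dist(x, supp f))sup|f|`.  B4 p. 573: *"|(D^η_{A,μ}G_k(Ω,A)f)(x)|, |(G_k(Ω,A)f)(x)| ≦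
c₀exp(−δ₀dist(x, supp f))‖f‖_∞ (1.10)"*.  (Docfix S-B1-g36-1 of ref-4 g36: relabelled; no declaration changed.)

WHAT THIS FILE PROVES (kernel-checked, zero `sorry`, theorems only; axioms standard).
* §1 **THEOREM (1.10), DERIVATIVE MEMBER WITH ITS DECAY FACTOR ON `T_ε`, MODULO THE CUBE INPUTS** — `norm_covDeriv_propagatorK_univ_decay_le`:
  for ANY `A`, `m² > 0`, `a_K ≧ 0`, given `‖D^ε_A(h_jG_j(h_jψ))‖_∞ ≦ γ_T‖ψ‖`, `‖K_jG_j(h_jψ)‖ ≦ β‖ψ‖` and `δ ≧ 0` with `2^dβe^{2δ·rS} ≦ ½`: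
  `‖(D^ε_AG^ε_K(T_ε,A)φ)(b)‖ ≦ 2·2^dγ_Te^{2δ·rS}e^{−δD}M` for `‖φ‖ ≦ M` vanishing within (1.3)-distance `D` of `b₋`.
* §2 `cube_inputs_deriv_bgVec` — BOTH torus-walk inputs at `Ã_j` for `A = A^{(K),ε}` needed here: `γ_T = C_T·(L^Kε)`, `β = C_β/K₀`, under
  `r·L^Kε ≦ c_A(K₀)` (cube inputs of gen 8 + `cube_input_deriv` at the common charge threshold, Leibniz assembly of `B1TorusCubeDeriv`).
* §3 **(2.25) DERIVATIVE CLAUSE WITH DECAY AT `A^{(K),ε}`** — `norm_covDeriv_propagatorK_bgVec_decay_of_cubes`: constants `c₀ > 0`, `K₀min`,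
  and per cube size a threshold `c_A(K₀) > 0` and a rate `δ₀(K₀) > 0` with `‖(D^ε_{A^{(K),ε}}G^ε_K(T_ε, A^{(K),ε})g)(b)‖ ≦
  c₀(L^Kε)·e^{−δ₀(K₀)·D/L^K}·M′` for `‖g‖ ≦ M′` vanishing within (1.3)-distance `D` of `b₋`, under gen 8's side conditions; packaging
  `norm_covDeriv_propagatorK_bgVec_decay` (`K₀ ∣ M`, `3K₀ ≦ 2M`).
HONEST SCOPE: derivative clause at the background's own field `A^{(K),ε}` (the value clause is `B1Ineq225DecayBackgroundTorus`; the Hölder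
clause (2.24) is not treated); `Ω = T_ε`; tori with `M·L′_μ = L^m`, `L` odd; constants existential; route to (2.22) = the weighted form of
(2.12) declared in `B4Eq222SupDecay`.  Unit `lit-balaban-p35` gen 9 (literature-prover-lit-balaban-p35-g9-0).
-/

open scoped BigOperators

namespace Literature.MathematicalPhysics.QuantumFieldTheory.Balaban1983to89.B1Ineq225DerivDecayBackgroundTorus

open Literature.MathematicalPhysics.QuantumFieldTheory.Balaban1983to89.HiggsLattice (ChargeData sderiv covDeriv)
open Literature.MathematicalPhysics.QuantumFieldTheory.Balaban1983to89.HiggsCovariance (propagatorK covOpK)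
open Literature.MathematicalPhysics.QuantumFieldTheory.Balaban1983to89.HiggsCovariancePos (isUnit_covOpK covOpK_mul_propagatorK)
open Literature.MathematicalPhysics.QuantumFieldTheory.Balaban1983to89.B3MultiscaleFields (toSite zeroCharge)
open Literature.MathematicalPhysics.QuantumFieldTheory.Balaban1983to89.B1Eq31Concrete (bgVec)
open Literature.MathematicalPhysics.QuantumFieldTheory.Balaban1983to89.B1Eq211ZeroFieldTorus (Shape)
open Literature.MathematicalPhysics.QuantumFieldTheory.Balaban1983to89.B1Ineq225DerivZeroFieldTorus (covDeriv_propagatorK_sup_bound)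
open Literature.MathematicalPhysics.QuantumFieldTheory.Balaban1983to89.B1TorusCubeCover (half Lab Near cube hTor card_filter_near_le sum_hTor_sq abs_hTor_le_one)
open Literature.MathematicalPhysics.QuantumFieldTheory.Balaban1983to89.B1TorusCubeLocality26 (rS cubeVec covOpK_hTor_agree commutator_row_zero
  near_rS_of_hTor_ne_zero near_rS_of_hTor_shift_ne_zero rS_succ_lt_half)
open Literature.MathematicalPhysics.QuantumFieldTheory.Balaban1983to89.B1TorusCubeChart (dd dd_succ castD toT toT_add_e1)
open Literature.MathematicalPhysics.QuantumFieldTheory.Balaban1983to89.B1TorusCubeBoxOp (acT cube_inputs)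
open Literature.MathematicalPhysics.QuantumFieldTheory.Balaban1983to89.B4Lemma22ReduceZero (Box)
open Literature.MathematicalPhysics.QuantumFieldTheory.Balaban1983to89.B4Lower18Regular (e1)
open Literature.MathematicalPhysics.QuantumFieldTheory.Balaban1983to89.B4PartitionUnity22 (hprof D1 D2 D1_nonneg D2_nonneg contDiff_hprof
  hasCompactSupport_hprof)
open Literature.MathematicalPhysics.QuantumFieldTheory.Balaban1983to89.B1Ineq225BackgroundTorus (apply_shift_sub_eq norm_sderiv_bgVec_le three_half_le_sites)
open Literature.MathematicalPhysics.QuantumFieldTheory.Balaban1983to89.B1Ineq225DecayBackgroundTorus (tdist_le_of_near eight_rS_le)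
open Literature.MathematicalPhysics.QuantumFieldTheory.Balaban1983to89.B4Eq222SupDecayObs (norm_obs_inverse_apply_le_of_dist)
open Literature.MathematicalPhysics.QuantumFieldTheory.Balaban1983to89.B1TorusCubeDeriv (covDeriv_hsmul norm_covDeriv_hsmul_le)
open Literature.MathematicalPhysics.QuantumFieldTheory.Balaban1983to89.B1TorusCubeDerivInput (cube_input_deriv)
open Literature.MathematicalPhysics.QuantumFieldTheory.Balaban1983to89.B1Ineq234LevelZero (tdist_triangle_real)
open Literature.MathematicalPhysics.QuantumFieldTheory.Balaban1983to89.B1Ineq234Concrete (tdist_self)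

variable {P : HiggsLattice.Params} {N : ℕ}

/-! ## §1 Theorem (1.10), derivative member with its decay factor on `T_ε`, modulo the cube inputs -/

section Torus

variable {K K₀ : ℕ}

/-- `D^ε_A(h_jF)(b) = 0` when `b₋` is off the core `{|x − Mj| ≦ rS}` (then `h_j(b₋) = h_j(b₊) = 0`). [cite: Balaban1983RegularityDecay, (2.7) p.576] -/
theorem covDeriv_hsmul_eq_zero_off (C : ChargeData N) (hK : K ≤ P.K) (hK₀ : K₀ ∣ P.M) (hK₀8 : 8 ≤ K₀) (j : Lab P K K₀)
    (A : HiggsLattice.VecField P 0) (F : HiggsLattice.ScalarField P 0 N) {b : HiggsLattice.PBond P 0}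
    (hb : ¬ Near K K₀ (rS P K K₀) j b.src) : covDeriv C A (hTor K K₀ j • F) b = 0 := by
  have h0 : hTor K K₀ j b.src = 0 := by
    by_contra h; exact hb (near_rS_of_hTor_ne_zero hK hK₀ hK₀8 h)
  have h1 : hTor K K₀ j b.tgt = 0 := by
    by_contra h; exact hb (near_rS_of_hTor_shift_ne_zero hK hK₀ hK₀8 h)
  rw [covDeriv_hsmul, h0, zero_smul, zero_add]
  unfold sderiv
  rw [h0, h1, sub_zero, smul_zero, zero_smul]

/-- **THEOREM (1.10), DERIVATIVE MEMBER WITH ITS DECAY FACTOR, ON THE TORUS `Ω = T_ε` — modulo the cube inputs.**  `m² > 0`, `a_K ≧ 0`,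
`K ≦ K_P`, `K₀ ∣ M_P`, `K₀ ≧ 8`, ANY `A`; per-cube inputs `‖D^ε_A(h_jG_j(h_jψ))‖_∞ ≦ γ_T‖ψ‖_∞` (Lemma 2.2 (2.17) derivative member +
Leibniz, `B1TorusCubeDeriv`), `‖(H_jh_j − h_jH_j)G_j(h_jψ)‖_∞ ≦ β‖ψ‖_∞`, and `δ ≧ 0` with `2^d·β·e^{δ·2rS} ≦ ½`.  Then for `‖φ(y)‖ ≦ M′`
vanishing at the sites within (1.3)-distance `< D` of `b₋`: `‖(D^ε_AG^ε_K(T_ε, A)φ)(b)‖ ≦ 2·2^d·γ_Te^{δ·2rS}·e^{−δD}·M′` — (2.12)–(2.13) for the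
observable `D^ε_A∘G` summed in the weighted sup norm (`B4Eq222SupDecayObs.norm_obs_inverse_apply_le_of_dist`).
[cite: Balaban1983RegularityDecay, Theorem (1.10) p.573; (2.12)–(2.13) p.577; (2.22) p.579] [cite: Balaban1982Higgs1, Prop. 2.1 (2.25) p.610] -/
theorem norm_covDeriv_propagatorK_univ_decay_le (C : ChargeData N) (hK : K ≤ P.K) (hK₀ : K₀ ∣ P.M) (hK₀8 : 8 ≤ K₀) {msq : ℝ}
    (hmsq : 0 < msq) (a : ℝ) (hak : 0 ≤ B1.aSeq a P.L K) (A : HiggsLattice.VecField P 0) {γT β : ℝ} (hγT : 0 ≤ γT) (hβ : 0 ≤ β)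
    (hTj : ∀ (j : Lab P K K₀) (ψ : HiggsLattice.ScalarField P 0 N),
      ‖(fun b => covDeriv C A (hTor K K₀ j • propagatorK C (cube K K₀ j) (cubeVec K K₀ j A) msq a K (hTor K K₀ j • ψ)) b :
        HiggsLattice.PBond P 0 → EuclideanSpace ℝ (Fin N))‖ ≤ γT * ‖ψ‖)
    (hKj : ∀ (j : Lab P K K₀) (ψ : HiggsLattice.ScalarField P 0 N),
      ‖covOpK C (cube K K₀ j) (cubeVec K K₀ j A) msq a K
          (hTor K K₀ j • propagatorK C (cube K K₀ j) (cubeVec K K₀ j A) msq a K (hTor K K₀ j • ψ))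
        - hTor K K₀ j • covOpK C (cube K K₀ j) (cubeVec K K₀ j A) msq a K
          (propagatorK C (cube K K₀ j) (cubeVec K K₀ j A) msq a K (hTor K K₀ j • ψ))‖ ≤ β * ‖ψ‖)
    {δ : ℝ} (hδ : 0 ≤ δ) (hsmall : (2 : ℝ) ^ P.d * β * Real.exp (δ * (2 * rS P K K₀)) ≤ 1 / 2)
    (φ : HiggsLattice.ScalarField P 0 N) {M : ℝ} (hφ : ∀ y, ‖φ y‖ ≤ M) {D : ℝ} (hD0 : 0 ≤ D) (b : HiggsLattice.PBond P 0)
    (hD : ∀ y, φ y ≠ 0 → D ≤ (HiggsLattice.Site.tdist b.src y : ℝ)) :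
    ‖covDeriv C A (propagatorK C Finset.univ A msq a K φ) b‖
      ≤ 2 * 2 ^ P.d * (γT * Real.exp (δ * (2 * rS P K K₀))) * Real.exp (-(δ * D)) * M := by
  classical
  have hK₀' : 1 ≤ K₀ := le_trans (by norm_num) hK₀8
  -- `D^ε_A` as a linear map into bond fields
  let ev : HiggsLattice.Site P 0 → (HiggsLattice.ScalarField P 0 N →ₗ[ℝ] EuclideanSpace ℝ (Fin N)) :=
    fun x => LinearMap.proj x
  let T : HiggsLattice.ScalarField P 0 N →ₗ[ℝ] (HiggsLattice.PBond P 0 → EuclideanSpace ℝ (Fin N)) :=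
    LinearMap.pi fun b : HiggsLattice.PBond P 0 => (P.mesh 0)⁻¹ •
      (((C.U (P.mesh 0) (A b)).toLinearMap).comp (ev b.tgt) - ev b.src)
  have hT : ∀ (ψ : HiggsLattice.ScalarField P 0 N) (b : HiggsLattice.PBond P 0), T ψ b = covDeriv C A ψ b := fun ψ b => rfl
  have h := norm_obs_inverse_apply_le_of_dist (X := HiggsLattice.Site P 0) (E := EuclideanSpace ℝ (Fin N)) (J := Lab P K K₀)
    (B := HiggsLattice.PBond P 0) (E' := EuclideanSpace ℝ (Fin N))
    (covOpK C Finset.univ A msq a K) (isUnit_covOpK C Finset.univ A hmsq a K hak)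
    (fun j => covOpK C (cube K K₀ j) (cubeVec K K₀ j A) msq a K)
    (fun j => propagatorK C (cube K K₀ j) (cubeVec K K₀ j A) msq a K)
    (fun j => covOpK_mul_propagatorK C (cube K K₀ j) (cubeVec K K₀ j A) hmsq a K hak)
    (hTor K K₀) (sum_hTor_sq hK hK₀ hK₀')
    (fun j ψ => covOpK_hTor_agree C hK hK₀ hK₀8 j A msq a ψ)
    (fun j => Finset.univ.filter (Near K K₀ (rS P K K₀) j))
    (fun j x hx => by
      rw [Finset.mem_filter]; exact ⟨Finset.mem_univ _, near_rS_of_hTor_ne_zero hK hK₀ hK₀8 hx⟩)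
    (fun j θ x hx => commutator_row_zero C hK hK₀ hK₀8 j A msq a θ (fun h => hx (by
      rw [Finset.mem_filter]; exact ⟨Finset.mem_univ _, h⟩)))
    (2 ^ P.d)
    (fun x => by
      have e : (Finset.univ.filter fun j : Lab P K K₀ => x ∈ Finset.univ.filter (Near K K₀ (rS P K K₀) j))
          = Finset.univ.filter fun j : Lab P K K₀ => Near K K₀ (rS P K K₀) j x := by
        ext j'; simp
      rw [e]
      exact card_filter_near_le hK hK₀ hK₀' (lt_trans (Nat.lt_succ_self _) (rS_succ_lt_half hK₀8)) x)
    hβ hKj T (fun b => b.src)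
    (fun j F b hb => by
      rw [hT]
      exact covDeriv_hsmul_eq_zero_off C hK hK₀ hK₀8 j A F (fun hn => hb (by
        rw [Finset.mem_filter]; exact ⟨Finset.mem_univ _, hn⟩)))
    hγT
    (fun j ψ => by
      have e : T (hTor K K₀ j • propagatorK C (cube K K₀ j) (cubeVec K K₀ j A) msq a K (hTor K K₀ j • ψ))
          = fun b => covDeriv C A (hTor K K₀ j • propagatorK C (cube K K₀ j) (cubeVec K K₀ j A) msq a K (hTor K K₀ j • ψ)) b :=
        funext fun b => hT _ b
      rw [e]; exact hTj j ψ)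
    (fun x y => (HiggsLattice.Site.tdist x y : ℝ)) (fun x => by exact_mod_cast tdist_self x) (fun x y => Nat.cast_nonneg _)
    (fun x y z => tdist_triangle_real x y z)
    (diam := 2 * rS P K K₀)
    (fun j y hy y' hy' => by
      rw [Finset.mem_filter] at hy hy'
      exact_mod_cast tdist_le_of_near hy.2 hy'.2)
    hδ (by push_cast; exact hsmall) φ hφ hD0 b hD
  rw [hT] at h
  have e2 : ((2 ^ P.d : ℕ) : ℝ) = 2 ^ P.d := by push_cast; ring
  rw [e2] at h
  exact h

end Torus

/-! ## §2 The cube inputs at `Ã_j` for the background `A^{(K),ε}`: derivative member and (2.20) factor -/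

section CubeInputs

set_option maxHeartbeats 400000 in
/-- **THE TORUS-WALK INPUTS FOR THE DERIVATIVE MEMBER AT THE BACKGROUND `A^{(K),ε}` OF (3.29)**: constants `C_T, C_β > 0` and thresholds
`c_A(K₀) > 0` such that for `K₀ ≧ 8`, on every torus with `K₀ ∣ M`, at every level `1 ≦ K ≦ K_P` with `3·L^KK₀ ≦ |T_ε|_μ`, `L^Kε ≦ ε₀`,
for `r·L^Kε ≦ c_A(K₀)`, `|A| ≦ r`, every cube satisfies `‖D^ε_{A^{(K),ε}}(h_jG_j(h_jψ))‖_∞ ≦ C_T(L^Kε)‖ψ‖_∞` (Lemma 2.2 (2.17) derivative +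
value members at `Ã_j`, Leibniz, «|∂^ηh_j| ≦ O(M⁻¹)») and `‖K_jG_j(h_jψ)‖_∞ ≦ (C_β/K₀)‖ψ‖_∞` ((2.20)) — gen 8's `cube_inputs` and this seat's
`cube_input_deriv` at the common charge `e_c = min(e₁, e₁′)`, with the (2.23)-regularity `norm_sderiv_bgVec_le` of the background.
[cite: Balaban1982Higgs1, (2.23) p.610, (3.29) p.617] [cite: Balaban1983RegularityDecay, Lemma 2.2 (2.17) p.578, (2.20) p.578, §2 p.577] -/
theorem cube_inputs_deriv_bgVec (d L : ℕ) (hd : 1 ≤ d) (hL : Odd L ∧ 1 < L) {a : ℝ} (ha : 0 < a)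
    {mu0sq msq : ℝ} (hmu : 0 < mu0sq) (hmsq : 0 < msq) (N : ℕ) (C : ChargeData N) (ε₀ : ℝ) :
    ∃ CT Cβ : ℝ, 0 < CT ∧ 0 < Cβ ∧ ∃ cA : ℕ → ℝ, (∀ K₀, 0 < cA K₀) ∧ ∀ K₀ : ℕ, 8 ≤ K₀ →
      ∀ (P : HiggsLattice.Params) (_S : Shape P), P.d = d → P.L = L → K₀ ∣ P.M →
      ∀ {K : ℕ}, 1 ≤ K → K ≤ P.K → (∀ μ, 3 * half P K K₀ ≤ P.sitesPerDir 0 μ) → P.mesh K ≤ ε₀ →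
      ∀ {r : ℝ}, r * P.mesh K ≤ cA K₀ →
      ∀ A : HiggsLattice.VecField P K, (∀ x, ‖toSite A x‖ ≤ r) → ∀ j : Lab P K K₀,
        (∀ ψ : HiggsLattice.ScalarField P 0 N,
            ‖(fun b => covDeriv C (bgVec mu0sq a K A) (hTor K K₀ j •
                propagatorK C (cube K K₀ j) (cubeVec K K₀ j (bgVec mu0sq a K A)) msq a K (hTor K K₀ j • ψ)) b :
              HiggsLattice.PBond P 0 → EuclideanSpace ℝ (Fin N))‖ ≤ CT * P.mesh K * ‖ψ‖) ∧
        (∀ ψ : HiggsLattice.ScalarField P 0 N,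
            ‖covOpK C (cube K K₀ j) (cubeVec K K₀ j (bgVec mu0sq a K A)) msq a K
                (hTor K K₀ j • propagatorK C (cube K K₀ j) (cubeVec K K₀ j (bgVec mu0sq a K A)) msq a K (hTor K K₀ j • ψ))
              - hTor K K₀ j • covOpK C (cube K K₀ j) (cubeVec K K₀ j (bgVec mu0sq a K A)) msq a K
                (propagatorK C (cube K K₀ j) (cubeVec K K₀ j (bgVec mu0sq a K A)) msq a K (hTor K K₀ j • ψ))‖
              ≤ Cβ / K₀ * ‖ψ‖) := by
  have hℓ0 : 1 ≤ L - 1 := by have := hL.2; omega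
  -- the constants of the cube inputs (Lemma 2.2 at charge 1: value/(2.20) and derivative members) and of the zero-field derivative clause
  obtain ⟨Cγ, Cβ, hCγ, hCβ, hci⟩ := cube_inputs C (d - 1) (L - 1) hℓ0 a a (msq * ε₀ ^ 2) ha
  obtain ⟨Cδ, hCδ, hdi⟩ := cube_input_deriv C (d - 1) (L - 1) hℓ0 a a (msq * ε₀ ^ 2) ha
  obtain ⟨c', hc', hder⟩ := covDeriv_propagatorK_sup_bound d L d hd hL ha hmu.le ε₀
  have hD1 := D1_nonneg contDiff_hprof hasCompactSupport_hprof
  have hD2 := D2_nonneg contDiff_hprof hasCompactSupport_hprof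
  -- the two charge thresholds for the regularity pair `(1, ½)`, as functions of the cube size, and the common charge
  have hci' : ∀ K₀ : ℕ, ∃ e₁ : ℝ, 0 < e₁ ∧ _ := fun K₀ => hci 1 (1 / 2) zero_le_one (by norm_num) (max K₀ 8) (le_max_right _ _)
  have hdi' : ∀ K₀ : ℕ, ∃ e₁ : ℝ, 0 < e₁ ∧ _ := fun K₀ => hdi 1 (1 / 2) zero_le_one (by norm_num) (max K₀ 8) (le_max_right _ _)
  choose e₁ he₁ hthr' using hci'
  choose e₂ he₂ hdthr' using hdi'
  refine ⟨Cδ + (d : ℝ) * (D1 hprof + D2 hprof) / 8 * Cγ, Cβ, by positivity, hCβ,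
    fun K₀ => Real.sqrt (min (e₁ K₀) (e₂ K₀)) / (|C.e| * a * c' + 1), fun K₀ => by
      have := he₁ K₀; have := he₂ K₀; have : 0 < min (e₁ K₀) (e₂ K₀) := lt_min (he₁ K₀) (he₂ K₀); positivity,
    fun K₀ hK₀8 => ?_⟩
  have hmax : max K₀ 8 = K₀ := max_eq_left hK₀8
  have hthr := hthr' K₀
  have hdthr := hdthr' K₀
  rw [hmax] at hthr hdthr
  intro P S hPd hPL hK₀M K hK1 hK hN3 hε r hr A hA j
  subst hPd
  set ec : ℝ := min (e₁ K₀) (e₂ K₀) with hec_def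
  have hec0 : 0 < ec := lt_min (he₁ K₀) (he₂ K₀)
  have hec1 : ec ≤ e₁ K₀ := min_le_left _ _
  have hec2 : ec ≤ e₂ K₀ := min_le_right _ _
  have hL1 : (1 : ℝ) < P.L := by rw [hPL]; exact_mod_cast hL.2
  have hdd : dd P = P.d - 1 := rfl
  have hPL1 : P.L - 1 = L - 1 := by rw [hPL]
  have hmesh : 0 < P.mesh K := P.mesh_pos K
  have hmesh0 : 0 < P.mesh 0 := P.mesh_pos 0
  have hK₀' : 1 ≤ K₀ := le_trans (by norm_num) hK₀8
  have hK₀r : (0 : ℝ) < K₀ := by exact_mod_cast hK₀'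
  have hcap : msq * P.mesh K ^ 2 ≤ msq * ε₀ ^ 2 :=
    mul_le_mul_of_nonneg_left (pow_le_pow_left₀ hmesh.le hε 2) hmsq.le
  have hr0 : 0 ≤ r := (norm_nonneg _).trans (hA (HiggsAveraging.blockIter K (default : HiggsLattice.Site P 0)))
  set Abg : HiggsLattice.VecField P 0 := bgVec mu0sq a K A with hAbg
  -- the regularity (2.23) of the background in the lineage's (1.7) form, at charge `e_c`, pair `(1, ½)`
  have hnR : ((((P.L - 1 + 1) ^ K : ℕ)) : ℝ) = (P.L : ℝ) ^ K := by
    rw [B1TorusCubeChart.predL_succ, Nat.cast_pow]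
  have hmeshK : P.mesh K = (P.L : ℝ) ^ K * P.mesh 0 := by
    unfold HiggsLattice.Params.mesh; ring
  have hD' := norm_sderiv_bgVec_le hK1 hL1 ha
    (fun ψ M' hψ b => hder P S rfl hPL (zeroCharge P.d) hK1 hK hε ψ M' hψ b) A hA
  have h17 : ∀ y ∈ Box (dd P) (P.L - 1) K (B1TorusCubeChart.M2 P K₀), ∀ i i' : Fin (dd P + 1),
      |acT K K₀ j ((((P.L - 1 + 1) ^ K : ℕ) : ℝ) * P.mesh 0 * C.e / ec) Abg (y + e1 i) i'
        - acT K K₀ j ((((P.L - 1 + 1) ^ K : ℕ) : ℝ) * P.mesh 0 * C.e / ec) Abg y i'|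
        ≤ 1 * ec ^ ((1 : ℝ) / 2 - 1) / ((P.L - 1 + 1) ^ K : ℕ) := by
    intro y _ i i'
    unfold acT
    rw [toT_add_e1, ← mul_sub, abs_mul, apply_shift_sub_eq, hnR]
    have hsd := (le_of_eq_of_le (Real.norm_eq_abs _).symm
      (PiLp.norm_apply_le (sderiv (toSite Abg) ⟨toT K K₀ j y, castD P i⟩) (castD P i'))).trans (hD' ⟨toT K K₀ j y, castD P i⟩)
    have hpow : (0 : ℝ) < (P.L : ℝ) ^ K := by positivity
    have hσ : |(P.L : ℝ) ^ K * P.mesh 0 * C.e / ec| = (P.L : ℝ) ^ K * P.mesh 0 * |C.e| / ec := by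
      rw [abs_div, abs_mul, abs_mul, abs_of_pos hpow, abs_of_pos hmesh0, abs_of_pos hec0]
    rw [hσ, abs_mul, abs_of_pos hmesh0]
    have hexp : ec ^ ((1 : ℝ) / 2 - 1) = (Real.sqrt (ec))⁻¹ := by
      rw [show (1 : ℝ) / 2 - 1 = -(1 / 2) by norm_num, Real.rpow_neg hec0.le, Real.sqrt_eq_rpow]
    rw [hexp, one_mul]
    -- the key smallness: `r·L^Kε·(|e| a c′) ≦ √e₁`, from `r·L^Kε ≦ c_A`
    have hkey : r * P.mesh K * (|C.e| * a * c') ≤ Real.sqrt (ec) := by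
      have h1 : r * P.mesh K * (|C.e| * a * c') ≤ r * P.mesh K * (|C.e| * a * c' + 1) :=
        mul_le_mul_of_nonneg_left (by linarith) (by positivity)
      refine h1.trans ?_
      have hr' := hr
      simp only at hr'
      rw [le_div_iff₀ (by positivity)] at hr'
      exact hr'
    calc (P.L : ℝ) ^ K * P.mesh 0 * |C.e| / ec * (P.mesh 0 * |(sderiv (toSite Abg) ⟨toT K K₀ j y, castD P i⟩) (castD P i')|)
        ≤ (P.L : ℝ) ^ K * P.mesh 0 * |C.e| / ec * (P.mesh 0 * (a * c' * (P.mesh K)⁻¹ * r)) :=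
          mul_le_mul_of_nonneg_left (mul_le_mul_of_nonneg_left hsd hmesh0.le) (by positivity)
      _ = (r * P.mesh K * (|C.e| * a * c')) / (ec * (P.L : ℝ) ^ K) := by
          rw [hmeshK]; field_simp
      _ ≤ Real.sqrt (ec) / (ec * (P.L : ℝ) ^ K) := div_le_div_of_nonneg_right hkey (by positivity)
      _ = (Real.sqrt (ec))⁻¹ / ((P.L : ℝ) ^ K) := by
          rw [← Real.sqrt_div_self, div_div]
  have hGK := hthr P hdd hPL1 K hK1 hK hK₀M hN3 a msq le_rfl le_rfl hmsq hcap j Abg ec hec0 hec1 h17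
  have hDD := hdthr P hdd hPL1 K hK1 hK hK₀M hN3 a msq le_rfl le_rfl hmsq hcap j Abg ec hec0 hec2 h17
  refine ⟨fun ψ => ?_, hGK.2⟩
  -- Leibniz assembly: `γ_D = C_δ(L^Kε)‖ψ‖`, `γ₀ = C_γ(L^Kε)²‖ψ‖`
  have hψ0 : 0 ≤ ‖ψ‖ := norm_nonneg _
  have hu : ∀ x, ‖propagatorK C (cube K K₀ j) (cubeVec K K₀ j Abg) msq a K (hTor K K₀ j • ψ) x‖ ≤ Cγ * P.mesh K ^ 2 * ‖ψ‖ :=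
    fun x => (norm_le_pi_norm _ x).trans (hGK.1 ψ)
  have hmain := norm_covDeriv_hsmul_le C hK hK₀M hK₀8 hN3 j Abg
    (propagatorK C (cube K K₀ j) (cubeVec K K₀ j Abg) msq a K (hTor K K₀ j • ψ)) (γD := Cδ * P.mesh K * ‖ψ‖)
    (γ0 := Cγ * P.mesh K ^ 2 * ‖ψ‖) (by positivity) (by positivity) (fun x μ hx hs => hDD ψ x μ hx hs) hu
  refine hmain.trans ?_
  -- `C_δ mesh ‖ψ‖ + (dd+1)(D₁+D₂)/K₀ · mesh⁻¹ · C_γ mesh² ‖ψ‖ ≦ (C_δ + d(D₁+D₂)/8 · C_γ) mesh ‖ψ‖`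
  have hdd1 : ((dd P : ℝ) + 1) = (P.d : ℝ) := by
    rw [← dd_succ P]; push_cast; ring
  rw [hdd1]
  have h8 : (P.d : ℝ) * (D1 hprof + D2 hprof) / K₀ ≤ (P.d : ℝ) * (D1 hprof + D2 hprof) / 8 :=
    div_le_div_of_nonneg_left (by positivity) (by norm_num) (by exact_mod_cast hK₀8)
  have e : (P.d : ℝ) * (D1 hprof + D2 hprof) / K₀ * (P.mesh K)⁻¹ * (Cγ * P.mesh K ^ 2 * ‖ψ‖)
      = (P.d : ℝ) * (D1 hprof + D2 hprof) / K₀ * (Cγ * P.mesh K * ‖ψ‖) := by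
    field_simp
  rw [e]
  calc Cδ * P.mesh K * ‖ψ‖ + (P.d : ℝ) * (D1 hprof + D2 hprof) / K₀ * (Cγ * P.mesh K * ‖ψ‖)
      ≤ Cδ * P.mesh K * ‖ψ‖ + (P.d : ℝ) * (D1 hprof + D2 hprof) / 8 * (Cγ * P.mesh K * ‖ψ‖) := by
        gcongr
    _ = (Cδ + (P.d : ℝ) * (D1 hprof + D2 hprof) / 8 * Cγ) * P.mesh K * ‖ψ‖ := by ring

end CubeInputs

/-! ## §3 (2.25), derivative clause with its decay factor, on `T_ε` at the background `A^{(K),ε}` -/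

section Main

/-- **PROP. 2.1 (2.25), DERIVATIVE CLAUSE WITH ITS DECAY FACTOR, ON `Ω = T_ε` AT THE BACKGROUND `A^{(K),ε}` OF (3.29) — B4's THEOREM (1.10)
DERIVATIVE MEMBER WITH `exp(−δ₀dist)` FOR THE (Higgs)₂,₃ CARRIER AT A REGULAR `A ≠ 0`.**  For `d ≧ 1`, odd `L > 1`, `a, μ₀², m² > 0`, `N`,
`(e, q)`, `ε₀`: constants `c₀ > 0`, `K₀min`, and per cube size `K₀` a threshold `c_A(K₀) > 0` and a rate `δ₀(K₀) > 0`, such that for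
`K₀ ≧ K₀min`, on every torus `M·L′_μ = L^m` with `K₀ ∣ M`, at every level `1 ≦ K ≦ K_P` with `3·L^KK₀ ≦ |T_ε|_μ`, `L^Kε ≦ ε₀`, for
`r·L^Kε ≦ c_A(K₀)`, every `|A(x)| ≦ r`, every `g` with `‖g‖_∞ ≦ M′` vanishing at the sites within (1.3)-distance `< D` of `b₋` (`D ≧ 0`):
`‖(D^ε_{A^{(K),ε}}G^ε_K(T_ε, A^{(K),ε})g)(b)‖ ≦ c₀(L^Kε)·exp(−δ₀(K₀)·D/L^K)·M′`.  Proof = §1 with §2, `δ = log 2/(2rS)`, `δ₀(K₀) = 4log 2/(5K₀ + 8)`.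
[cite: Balaban1982Higgs1, Prop. 2.1 (2.25) p.610; (3.29) p.617] [cite: Balaban1983RegularityDecay, Theorem (1.10) p.573; (2.22) p.579] -/
theorem norm_covDeriv_propagatorK_bgVec_decay_of_cubes (d L : ℕ) (hd : 1 ≤ d) (hL : Odd L ∧ 1 < L) {a : ℝ} (ha : 0 < a)
    {mu0sq msq : ℝ} (hmu : 0 < mu0sq) (hmsq : 0 < msq) (N : ℕ) (C : ChargeData N) (ε₀ : ℝ) :
    ∃ c₀ : ℝ, 0 < c₀ ∧ ∃ K₀min : ℕ, ∃ cA δA : ℕ → ℝ, (∀ K₀, 0 < cA K₀ ∧ 0 < δA K₀) ∧ ∀ K₀ : ℕ, K₀min ≤ K₀ →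
      ∀ (P : HiggsLattice.Params) (_S : Shape P), P.d = d → P.L = L → K₀ ∣ P.M →
      ∀ {K : ℕ}, 1 ≤ K → K ≤ P.K → (∀ μ, 3 * half P K K₀ ≤ P.sitesPerDir 0 μ) → P.mesh K ≤ ε₀ →
      ∀ {r : ℝ}, r * P.mesh K ≤ cA K₀ →
      ∀ A : HiggsLattice.VecField P K, (∀ x, ‖toSite A x‖ ≤ r) →
        ∀ (g : HiggsLattice.ScalarField P 0 N) (M D : ℝ), (∀ x, ‖g x‖ ≤ M) → 0 ≤ D →
          ∀ b : HiggsLattice.PBond P 0, (∀ z, g z ≠ 0 → D ≤ (HiggsLattice.Site.tdist b.src z : ℝ)) →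
            ‖covDeriv C (bgVec mu0sq a K A) (propagatorK C Finset.univ (bgVec mu0sq a K A) msq a K g) b‖
              ≤ c₀ * P.mesh K * Real.exp (-(δA K₀ * (D / (P.L : ℝ) ^ K))) * M := by
  obtain ⟨CT, Cβ, hCT, hCβ, cA, hcA, hcube⟩ := cube_inputs_deriv_bgVec d L hd hL ha hmu hmsq N C ε₀
  have hlog2 : 0 < Real.log 2 := Real.log_pos (by norm_num)
  refine ⟨4 * 2 ^ d * CT, by positivity, max 8 (⌈(2 : ℝ) ^ (d + 2) * Cβ⌉₊), cA, fun K₀ => Real.log 2 * 4 / (5 * K₀ + 8),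
    fun K₀ => ⟨hcA K₀, div_pos (mul_pos hlog2 (by norm_num)) (by positivity)⟩, fun K₀ hK₀ => ?_⟩
  have hK₀8 : 8 ≤ K₀ := le_trans (le_max_left _ _) hK₀
  have hK₀C : (2 : ℝ) ^ (d + 2) * Cβ ≤ K₀ :=
    (Nat.le_ceil _).trans (by exact_mod_cast le_trans (le_max_right _ _) hK₀)
  have h22 : (2 : ℝ) ^ (d + 2) = 2 ^ d * 4 := by rw [pow_add]; norm_num
  rw [h22] at hK₀C
  intro P S hPd hPL hK₀M K hK1 hK hN3 hε r hr A hA g M D hg hD0 b hD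
  have hcj := fun j => hcube K₀ hK₀8 P S hPd hPL hK₀M hK1 hK hN3 hε hr A hA j
  subst hPd
  have hL1 : (1 : ℝ) < P.L := by rw [hPL]; exact_mod_cast hL.2
  have hmesh : 0 < P.mesh K := P.mesh_pos K
  have hakP : 0 ≤ B1.aSeq a P.L K := (B1.aSeq_pos ha hL1 hK1).le
  have hM0 : 0 ≤ M := (norm_nonneg _).trans (hg b.src)
  have hK₀pos : (0 : ℝ) < K₀ := by exact_mod_cast (show 0 < K₀ by omega)
  have hrS : (0 : ℝ) < rS P K K₀ := by
    have : 1 ≤ rS P K K₀ := by unfold rS; have := Nat.one_le_pow K P.L P.hL; omega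
    exact_mod_cast this
  set δ : ℝ := Real.log 2 / (2 * rS P K K₀) with hδ_def
  have hδ0 : 0 ≤ δ := by positivity
  have hexp : Real.exp (δ * (2 * rS P K K₀)) = 2 := by
    rw [hδ_def, div_mul_cancel₀ _ (by positivity), Real.exp_log two_pos]
  have hsmall : (2 : ℝ) ^ P.d * (Cβ / K₀) * Real.exp (δ * (2 * rS P K K₀)) ≤ 1 / 2 := by
    rw [hexp]
    have e : (2 : ℝ) ^ P.d * (Cβ / K₀) * 2 = (2 ^ P.d * 2 * Cβ) / K₀ := by ring
    rw [e, div_le_iff₀ hK₀pos]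
    linarith
  have hmain := norm_covDeriv_propagatorK_univ_decay_le C hK hK₀M hK₀8 hmsq a hakP (bgVec mu0sq a K A) (γT := CT * P.mesh K)
    (β := Cβ / K₀) (by positivity) (by positivity) (fun j ψ => (hcj j).1 ψ) (fun j ψ => (hcj j).2 ψ) hδ0 hsmall g hg hD0 b hD
  rw [hexp] at hmain
  have h8 : 8 * (rS P K K₀ : ℝ) ≤ (5 * (K₀ : ℝ) + 8) * (P.L : ℝ) ^ K := by
    have h := eight_rS_le (P := P) (K := K) (K₀ := K₀)
    have h' : ((8 * rS P K K₀ : ℕ) : ℝ) ≤ ((5 * half P K K₀ + 8 * P.L ^ K : ℕ) : ℝ) := by exact_mod_cast h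
    unfold half at h'
    push_cast at h'
    linarith
  have hcmp : Real.log 2 * 4 / (5 * (K₀ : ℝ) + 8) * (D / (P.L : ℝ) ^ K) ≤ δ * D := by
    rw [hδ_def, div_mul_div_comm, div_mul_eq_mul_div, div_le_div_iff₀ (by positivity) (by positivity)]
    have hlogD : 0 ≤ Real.log 2 * D := mul_nonneg hlog2.le hD0
    calc Real.log 2 * 4 * D * (2 * (rS P K K₀ : ℝ)) = Real.log 2 * D * (8 * (rS P K K₀ : ℝ)) := by ring
      _ ≤ Real.log 2 * D * ((5 * (K₀ : ℝ) + 8) * (P.L : ℝ) ^ K) := mul_le_mul_of_nonneg_left h8 hlogD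
  have hexpD : Real.exp (-(δ * D)) ≤ Real.exp (-(Real.log 2 * 4 / (5 * (K₀ : ℝ) + 8) * (D / (P.L : ℝ) ^ K))) :=
    Real.exp_le_exp.2 (by linarith)
  calc ‖covDeriv C (bgVec mu0sq a K A) (propagatorK C Finset.univ (bgVec mu0sq a K A) msq a K g) b‖
      ≤ 2 * 2 ^ P.d * (CT * P.mesh K * 2) * Real.exp (-(δ * D)) * M := hmain
    _ ≤ 2 * 2 ^ P.d * (CT * P.mesh K * 2) * Real.exp (-(Real.log 2 * 4 / (5 * (K₀ : ℝ) + 8) * (D / (P.L : ℝ) ^ K))) * M :=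
        mul_le_mul_of_nonneg_right (mul_le_mul_of_nonneg_left hexpD (by positivity)) hM0
    _ = 4 * 2 ^ P.d * CT * P.mesh K * Real.exp (-(Real.log 2 * 4 / (5 * (K₀ : ℝ) + 8) * (D / (P.L : ℝ) ^ K))) * M := by ring

/-- **THE SAME, WITH THE CUBE CONDITION AS `K₀ ∣ M`, `3K₀ ≦ 2M`** (then `3·L^KK₀ ≦ |T_ε|_μ` at every level `K ≦ K_P`).
[cite: Balaban1982Higgs1, Prop. 2.1 (2.25) p.610; (3.29) p.617] [cite: Balaban1983RegularityDecay, Theorem (1.10) p.573] -/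
theorem norm_covDeriv_propagatorK_bgVec_decay (d L : ℕ) (hd : 1 ≤ d) (hL : Odd L ∧ 1 < L) {a : ℝ} (ha : 0 < a) {mu0sq msq : ℝ}
    (hmu : 0 < mu0sq) (hmsq : 0 < msq) (N : ℕ) (C : ChargeData N) (ε₀ : ℝ) :
    ∃ c₀ : ℝ, 0 < c₀ ∧ ∃ K₀min : ℕ, ∃ cA δA : ℕ → ℝ, (∀ K₀, 0 < cA K₀ ∧ 0 < δA K₀) ∧ ∀ K₀ : ℕ, K₀min ≤ K₀ →
      ∀ (P : HiggsLattice.Params) (_S : Shape P), P.d = d → P.L = L → K₀ ∣ P.M → 3 * K₀ ≤ 2 * P.M →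
      ∀ {K : ℕ}, 1 ≤ K → K ≤ P.K → P.mesh K ≤ ε₀ →
      ∀ {r : ℝ}, r * P.mesh K ≤ cA K₀ →
      ∀ A : HiggsLattice.VecField P K, (∀ x, ‖toSite A x‖ ≤ r) →
        ∀ (g : HiggsLattice.ScalarField P 0 N) (M D : ℝ), (∀ x, ‖g x‖ ≤ M) → 0 ≤ D →
          ∀ b : HiggsLattice.PBond P 0, (∀ z, g z ≠ 0 → D ≤ (HiggsLattice.Site.tdist b.src z : ℝ)) →
            ‖covDeriv C (bgVec mu0sq a K A) (propagatorK C Finset.univ (bgVec mu0sq a K A) msq a K g) b‖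
              ≤ c₀ * P.mesh K * Real.exp (-(δA K₀ * (D / (P.L : ℝ) ^ K))) * M := by
  obtain ⟨c₀, hc₀, K₀min, cA, δA, hcδ, h⟩ := norm_covDeriv_propagatorK_bgVec_decay_of_cubes d L hd hL ha hmu hmsq N C ε₀
  exact ⟨c₀, hc₀, K₀min, cA, δA, hcδ, fun K₀ hK₀ P S hPd hPL hK₀M h3M K hK1 hK hε r hr A hA g M D hg hD0 b hD =>
    h K₀ hK₀ P S hPd hPL hK₀M hK1 hK (three_half_le_sites hK h3M) hε hr A hA g M D hg hD0 b hD⟩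

end Main

end Literature.MathematicalPhysics.QuantumFieldTheory.Balaban1983to89.B1Ineq225DerivDecayBackgroundTorus
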